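import Summits.QuantumFields.YangMills.Theorems.ConvexGribovBodyCovarianceBoundDefsB
import Summits.QuantumFields.YangMills.Theorems.ConvexGribovBodyCovarianceBoundStubSupMeasurable
import Summits.QuantumFields.YangMills.Theorems.ConvexGribovBodyCovarianceBoundStubProjSplit
import Literature.MeasureTheory.RandomSets.MeasurableSelection

/-!
# Measurable maximising minimiser selections (crux stmt-QuantumFields-8780, line `Sketch`)

The two open window stubs of the line (`stub_zeroFreeWindowLie`, `stub_zeroFreeWindowPerp`) ask for
`∃ sel, Measurable sel ∧ (∀ U, IsCoulMin r S U (sel U)) ∧ (∀ U, froSq (… (sel U)) = sup…) ∧ (zero-free …)`.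
This file discharges the CLASSICAL part of that clause once and for all: by the measurable maximum
theorem (Kuratowski–Ryll-Nardzewski, tree `Literature.MeasureTheory.RandomSets.exists_measurable_argmax_selector`)
applied to the closed-graph correspondence `U ↦ argmin coul(U, ·)` (`isClosed_isCoulMin`) on the compact
metrisable `Site → G` and the jointly continuous `froSq ∘ lieCosMode` / `froSq ∘ perpCosMode`, there are
Borel measurable selections of absolute Coulomb minimisers attaining `supLieCosSq` resp. `supPerpCosSq`
at EVERY configuration. What remains of the windows is exactly their zero-freeness (the physics).
-/

set_option autoImplicit false

noncomputable section

namespace Summit.QuantumFields.YangMills.Cruxes.CovarianceBound.SupportWindow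

open scoped BigOperators Matrix ComplexConjugate Topology
open MeasureTheory Set
open Literature.MathematicalPhysics.QuantumFieldTheory Literature.MeasureTheory.RandomSets

namespace MaxSelection

variable {G : Type} [Group G] [TopologicalSpace G]

/-- A compact group with a faithful continuous matrix representation is a Polish space (closed
embedding into `M_N(ℂ)`). -/
theorem polishSpace_of_latticeRep [CompactSpace G] (r : LatticeRep G) : PolishSpace G :=
  haveI : PolishSpace (Matrix (Fin r.N) (Fin r.N) ℂ) :=
    inferInstanceAs (PolishSpace (Fin r.N → Fin r.N → ℂ))
  (r.continuous.isClosedEmbedding r.injective).polishSpace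

/-- **Measurable argmax over the Coulomb minimisers** (abstract form used twice below): for a jointly
continuous `f`, there is a Borel measurable selection of absolute Coulomb minimisers maximising
`f (U, ·)` over `argmin coul(U, ·)` at every `U`. -/
theorem exists_measurable_sel_isMaxOn [IsTopologicalGroup G] [CompactSpace G] [MeasurableSpace G]
    [BorelSpace G] (r : LatticeRep G) (S : ℕ)
    (f : GaugeConfig 4 (2 * S + 1) G × (Site 4 (2 * S + 1) → G) → ℝ) (hf : Continuous f) :
    ∃ sel : GaugeConfig 4 (2 * S + 1) G → (Site 4 (2 * S + 1) → G),
      Measurable sel ∧ (∀ U, IsCoulMin r S U (sel U)) ∧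
      ∀ U h, IsCoulMin r S U h → f (U, h) ≤ f (U, sel U) := by
  haveI : SecondCountableTopology G :=
    (r.continuous.isClosedEmbedding r.injective).isEmbedding.secondCountableTopology
  haveI : PolishSpace G := polishSpace_of_latticeRep r
  obtain ⟨g, hgm, hg⟩ := exists_measurable_argmax_selector
    (X := GaugeConfig 4 (2 * S + 1) G) (Y := Site 4 (2 * S + 1) → G)
    (fun U => {h | IsCoulMin r S U h}) (fun U => SupMeasurable.exists_isCoulMin r S U)
    (SupMeasurable.isClosed_isCoulMin r S) f hf
  exact ⟨g, hgm, fun U => (hg U).1, fun U h hh => (hg U).2 h hh⟩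

/-- A maximiser over the (nonempty) minimiser subtype attains the `iSup`. -/
theorem iSup_eq_of_isMax {S : ℕ} {r : LatticeRep G} {U : GaugeConfig 4 (2 * S + 1) G}
    (φ : (Site 4 (2 * S + 1) → G) → ℝ) {h₀ : Site 4 (2 * S + 1) → G} (h₀min : IsCoulMin r S U h₀)
    (hmax : ∀ h, IsCoulMin r S U h → φ h ≤ φ h₀) :
    (⨆ h : {h : Site 4 (2 * S + 1) → G // IsCoulMin r S U h}, φ h.1) = φ h₀ := by
  have hbdd : BddAbove (Set.range fun h : {h : Site 4 (2 * S + 1) → G // IsCoulMin r S U h} => φ h.1) :=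
    ⟨φ h₀, by rintro _ ⟨h, rfl⟩; exact hmax h.1 h.2⟩
  haveI : Nonempty {h : Site 4 (2 * S + 1) → G // IsCoulMin r S U h} := ⟨⟨h₀, h₀min⟩⟩
  exact le_antisymm (ciSup_le fun h => hmax h.1 h.2) (le_ciSup hbdd ⟨h₀, h₀min⟩)

end MaxSelection

open MaxSelection in
/-- **Helper stub `exists_measurable_maximising_selection`**: for every compact `G` with a faithful
continuous unitary representation `r`, every torus size, momentum and polarisation there are Borel
measurable selections `sel` of absolute lattice Coulomb minimisers attaining, at EVERY configuration
`U`, the supremum over the minimisers of `‖P_𝔤 Ĉ_j(p)‖²_F` (resp. of `‖Ĉ_j(p) − P_𝔤 Ĉ_j(p)‖²_F`) —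
the selection clauses of `stub_zeroFreeWindowLie` / `stub_zeroFreeWindowPerp` (measurable maximum
theorem on the closed-graph argmin correspondence; Kuratowski–Ryll-Nardzewski). -/
theorem exists_measurable_maximising_selection :
    ∀ (G : Type) [Group G] [TopologicalSpace G] [IsTopologicalGroup G] [CompactSpace G]
      [MeasurableSpace G] [BorelSpace G] (r : LatticeRep G) (S : ℕ) (p : Fin 3 → ZMod (2 * S + 1))
      (j : Fin 3),
      (∃ sel : GaugeConfig 4 (2 * S + 1) G → (Site 4 (2 * S + 1) → G),
        Measurable sel ∧ (∀ U, IsCoulMin r S U (sel U)) ∧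
        ∀ U, froSq (lieCosMode r S p j U (sel U)) = supLieCosSq r S p j U) ∧
      (∃ sel : GaugeConfig 4 (2 * S + 1) G → (Site 4 (2 * S + 1) → G),
        Measurable sel ∧ (∀ U, IsCoulMin r S U (sel U)) ∧
        ∀ U, froSq (perpCosMode r S p j U (sel U)) = supPerpCosSq r S p j U) := by
  intro G _ _ _ _ _ _ r S p j
  refine ⟨?_, ?_⟩
  · obtain ⟨sel, hm, hmin, hmax⟩ := exists_measurable_sel_isMaxOn r S
      (fun q => froSq (lieCosMode r S p j q.1 q.2)) (ProjSplit.continuous_froSq_lieCosMode r S p j)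
    refine ⟨sel, hm, hmin, fun U => ?_⟩
    unfold supLieCosSq
    exact (iSup_eq_of_isMax (fun h => froSq (lieCosMode r S p j U h)) (hmin U)
      (fun h hh => hmax U h hh)).symm
  · obtain ⟨sel, hm, hmin, hmax⟩ := exists_measurable_sel_isMaxOn r S
      (fun q => froSq (perpCosMode r S p j q.1 q.2)) (ProjSplit.continuous_froSq_perpCosMode r S p j)
    refine ⟨sel, hm, hmin, fun U => ?_⟩
    unfold supPerpCosSq
    exact (iSup_eq_of_isMax (fun h => froSq (perpCosMode r S p j U h)) (hmin U)
      (fun h hh => hmax U h hh)).symm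

end Summit.QuantumFields.YangMills.Cruxes.CovarianceBound.SupportWindow

end
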